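import Mathlib
import HarnessLib
import Summits.ResolutionOfSingularities.ResolutionOfSingularities.Theorems.WildQuotientsWildQuotientResolutionToricExitJordanFourFinalOfRingBrickT
import Summits.ResolutionOfSingularities.ResolutionOfSingularities.Theorems.WildQuotientsWildQuotientResolutionJordanFourOrder
import Summits.ResolutionOfSingularities.ResolutionOfSingularities.Theorems.WildQuotientsWildQuotientResolutionJordanFourBrickH1W

/-!
# V4U-F: every `𝔸ⁿ/J₄` has a resolution of singularities (all `p ≥ 5`)
(crux stmt-ResolutionOfSingularities-15640 `WildQuotients.WildQuotientResolution`, line `Sketch`;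
chain w45c programme V4U FINAL `jordanFour_hasResolution` — REGISTERED stub of the crux item
(V4U-DESIGN §5 FINAL SHAPE = the `hJ4` of p490375/p490809); `L/w45c/CHAIN.md` v7.x §4 lead-1 row;
[OURS · L1 W4.5c] — NOT a statement of any manuscript; replaces the role of no printed item.)

`JordanFour.jordanFour_hasResolution`: for every field `k` of characteristic `p ≥ 5`, every `n`
and the `J₄` datum `σ` on `k[x₁,…,xₙ]` (`σ x_a = x_a`, `σ x_b = x_b + x_a`, `σ x_c = x_c + x_b`,
`σ x_d = x_d + x_c`, the other variables fixed — a Jordan block of size 4 plus passengers), the wild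
quotient `Spec k[x]^⟨σ⟩` has a resolution of singularities. Proof = the three-piece toric exit of
`V4U-DESIGN.md`: `V = Bl_{I₆} 𝔸ⁿ` with the lifted action; pieces `V[x_a²]` (μ₃ root chart, quotient
a `⅓(1,1,2)`-cone × 𝔸), `W_T` (twisted root chart, quotient a localised `½(1,1,1)`-cone × 𝔸) and
the terminal piece inside `V[x_c⁶]`; the two cones are resolved by one blow-up of their reduced
vertex lines — assembled by `jordanFour_hasResolution_of_ringBricks` (p512651) / `_of_ringBrickT` (p518651) from the bricks of
stub-1…5 and the reserve typers, with the two ring-level cone bricks `H₀` = `JordanFour.brickH0` (res-type-087, p515853) and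
`H₁` = `JordanFour.brickH1W` (res-D-pv-033 AS stub-5 over res-L1-w45c-stub-1's ring side, p519150). WORDING OF RECORD: no claim of novelty in print; AI-written, kernel-checked, weaker
than expert review.
-/

-- single-problem summit: the doubled namespace component `ResolutionOfSingularities` is forced
set_option linter.dupNamespace false

noncomputable section

open CategoryTheory AlgebraicGeometry TopologicalSpace MvPolynomial
open Literature.AlgebraicGeometry.Resolution Literature.AlgebraicGeometry.RelativeSpec

namespace Summit.ResolutionOfSingularities.ResolutionOfSingularities.Theorems.WildQuotientResolution.JordanFour

/-- **V4U-F `jordanFour_hasResolution`**: the wild quotient singularity `𝔸ⁿ/J₄` (Jordan block of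
size four plus passengers, characteristic `p ≥ 5`, any field) has a resolution of singularities.
[OURS · L1 W4.5c] [folklore; assembly of landed decls] -/
theorem jordanFour_hasResolution (p : ℕ) (hp : p.Prime) (hp5 : 5 ≤ p) (k : Type) [Field k]
    [CharP k p] (n : ℕ) (σ : MvPolynomial (Fin n) k ≃ₐ[k] MvPolynomial (Fin n) k)
    (a b c d : Fin n) (hab : a ≠ b) (hac : a ≠ c) (had : a ≠ d) (hbc : b ≠ c) (hbd : b ≠ d)
    (hcd : c ≠ d) (hb : σ (X b) = X b + X a) (hc : σ (X c) = X c + X b)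
    (hd : σ (X d) = X d + X c) (hσ : ∀ i, i ≠ b → i ≠ c → i ≠ d → σ (X i) = X i) :
    Scheme.HasResolution
      (Spec (.of (FixedPoints.subalgebra k (MvPolynomial (Fin n) k) (Subgroup.zpowers σ)))) := by
  haveI : Fact (Nat.Prime p) := ⟨hp⟩
  haveI : Finite ↥(Subgroup.zpowers σ) := Nat.finite_of_card_ne_zero (by
    rw [card_zpowers_prime k n σ a b c d hab hac had hb hc hd hσ p hp hp5]; exact hp.ne_zero)
  exact jordanFour_hasResolution_of_ringBrickT p hp hp5 k n σ a b c d hab hac had hbc hbd hcd hb hc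
    hd hσ (brickH1W p hp hp5 k n σ a b c d hab hac had hbc hbd hcd hb hc hd hσ)

end Summit.ResolutionOfSingularities.ResolutionOfSingularities.Theorems.WildQuotientResolution.JordanFour

end
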